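import Mathlib.Analysis.SpecialFunctions.Exponential
import Mathlib.Analysis.SpecialFunctions.Trigonometric.Deriv
import Literature.MathematicalPhysics.QuantumLattice.FermionTraceFactorization
import Literature.MathematicalPhysics.QuantumLattice.HubbardBondAlgebra
import Literature.MathematicalPhysics.QuantumLattice.HubbardWave0LiebProofs
import HarnessLib

/-!
# The on-site pairing (BCS/Bogoliubov) block, I: operator algebra of `ξ(n↑+n↓) + Δ(c↓c↑ + h.c.)`

Topic `MathematicalPhysics/QuantumLattice`. For two distinct orbitals `a, b` of the
Jordan–Wigner Fock space `Fock ι` (on a Hubbard lattice: `a = (x,↑)`, `b = (x,↓)`) and real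
`ξ, Δ`, the two-mode Bogoliubov–de Gennes Hamiltonian

  `h = ξ (n_a + n_b) + Δ (c_b c_a + c†_a c†_b)`

has spectrum `{ξ, ξ, ξ - E, ξ + E}`, `E = √(ξ² + Δ²)`, on the four two-mode states; we PROVE the
corresponding operator algebra and the trace formula in the full Fock space:

* the hard-core boson relations of `P = c_b c_a`: `P² = 0`, `P Pᴴ = (1-n_a)(1-n_b)` (expanded),
  `Pᴴ P = n_a n_b`, `n_a P = n_b P = 0`, `P n_a = P n_b = P`;
* with `N' = n_a + n_b - 1`, `S = P + Pᴴ`, `Q = N'²`: `N'S + SN' = 0`, `S² = Q`, `Q² = Q`,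
  `Q N' = N'`, `Q S = S`; hence for the traceless block `X = ξ N' + Δ S`:
  `X² = (ξ² + Δ²) Q`, `Q X = X Q = X`;
* `exp_smul_of_isIdempotentElem` — `e^{cP} = 1 + (e^c - 1) P` for an idempotent `P` of a complete
  normed `ℂ`-algebra (used in part II for the spectral projections of `X`).

Part II (`OnSitePairingTrace.lean`) computes `e^{-βX}` and `Tr e^{-βh} = 2^{|ι|} e^{-βξ} cosh²(βE/2)`.
This is the one-mode-pair algebra behind the BCS/BdG free energy (Bardeen–Cooper–Schrieffer
1957, §III; de Gennes 1966, Ch. 4; von Delft–Ralph 2001, §4.2: pair operators `b_j = c_{j-}c_{j+}`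
with `b_j² = 0`, `[b_j, b_j†] = 1 - n_{j+} - n_{j-}`), written for the tree's concrete
Jordan–Wigner matrices so that it combines with the trace factorisation over sites
(`FermionTraceFactorization`). Everything is proved; no definition and no named fact.

## Mathlib / tree search

Tree: CAR discharges (`annihilation_mul_creation`, `creation_mul_creation_eq_neg`,
`LiebThm1.annihilation_mul_self`, `LiebThm1.annihilation_mul_annihilation_eq_neg`, `creation_mul_self`,
`number_mul_creation_of_ne`),
`numberAt_idempotent`, `numberAt_commute`, `numberAt_isHermitian` (`FermionOperators*`),
(`FermionTraceFactorization` imports). Mathlib: `NormedSpace.exp_series_hasSum_exp'`,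
`IsIdempotentElem.pow_succ_eq`. No BCS/BdG block algebra existed
(`lean search 'bdg|cosh.*trace|trace.*cosh'`: nothing fermionic).

## References

* J. Bardeen, L. N. Cooper, J. R. Schrieffer, Phys. Rev. 108 (1957) 1175, §III.
* P. G. de Gennes, *Superconductivity of Metals and Alloys* (Benjamin 1966), Ch. 4–5. [deGennes1966]
* J. von Delft, D. C. Ralph, Phys. Rep. 345 (2001) 61, §4.2. [VondelftRalph2001]
-/

noncomputable section

namespace Literature.MathematicalPhysics.QuantumLattice

open Matrix Finset HubbardWave0 LiebThm1
open scoped Matrix.Norms.L2Operator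

/-! ### Exponential of an idempotent -/

section Idempotent

variable {𝔸 : Type*} [NormedRing 𝔸] [NormedAlgebra ℂ 𝔸] [CompleteSpace 𝔸]

/-- **`e^{cP} = 1 + (e^c - 1)P`** for an idempotent `P` (`P^n = P`, `n ≥ 1`, in the exponential
series). [folklore] -/
theorem exp_smul_of_isIdempotentElem {P : 𝔸} (hP : IsIdempotentElem P) (c : ℂ) :
    NormedSpace.exp (c • P) = 1 + (Complex.exp c - 1) • P := by
  have h1 := NormedSpace.exp_series_hasSum_exp' (𝕂 := ℂ) (c • P)
  have h2 : HasSum (fun n : ℕ => ((Nat.factorial n : ℂ)⁻¹ • c ^ n)) (Complex.exp c) := by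
    rw [Complex.exp_eq_exp_ℂ]
    exact NormedSpace.exp_series_hasSum_exp' (𝕂 := ℂ) c
  have h3 : HasSum (fun n : ℕ => ((Nat.factorial n : ℂ)⁻¹ • c ^ n) • P) (Complex.exp c • P) :=
    h2.smul_const P
  have h4 : HasSum (fun n : ℕ => if n = 0 then (1 : 𝔸) - P else 0) (1 - P) := hasSum_ite_eq 0 _
  have h5 : (fun n : ℕ => ((Nat.factorial n : ℂ)⁻¹) • (c • P) ^ n) =
      fun n : ℕ => ((Nat.factorial n : ℂ)⁻¹ • c ^ n) • P + (if n = 0 then (1 : 𝔸) - P else 0) := by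
    funext n
    rcases Nat.eq_zero_or_pos n with rfl | hn
    · simp
    · obtain ⟨m, rfl⟩ := Nat.exists_eq_add_one_of_ne_zero hn.ne'
      rw [if_neg (Nat.succ_ne_zero m), add_zero, smul_pow, hP.pow_succ_eq, smul_smul, smul_eq_mul]
  rw [h5] at h1
  have h6 := h1.unique (h3.add h4)
  rw [h6, sub_smul, one_smul]
  abel

end Idempotent

/-! ### The pair operator `P = c_b c_a` of two distinct orbitals and its algebra -/

section PairAlgebra

variable {ι : Type*} [LinearOrder ι] [Fintype ι]

/-- `n_i c_j = c_j n_i` for `i ≠ j`. [folklore] -/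
theorem numberAt_mul_annihilation_of_ne {i j : ι} (h : i ≠ j) :
    numberAt i * annihilation j = annihilation j * numberAt i := by
  have h1 : (creation i * annihilation i * creation j)ᴴ = (creation j * (creation i * annihilation i))ᴴ := by
    rw [number_mul_creation_of_ne h]
  rw [conjTranspose_mul, conjTranspose_mul (creation j), creation_conjTranspose] at h1
  change annihilation j * (numberAt i)ᴴ = (numberAt i)ᴴ * annihilation j at h1
  rw [(numberAt_isHermitian i).eq] at h1
  exact h1.symm

/-- `n_i c_i = 0`. [folklore] -/
theorem numberAt_mul_annihilation_self (i : ι) : numberAt i * annihilation i = 0 := by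
  rw [numberAt, mul_assoc, annihilation_mul_self, mul_zero]

/-- `c_i n_i = c_i`. [folklore] -/
theorem annihilation_mul_numberAt_self (i : ι) : annihilation i * numberAt i = annihilation i := by
  rw [numberAt, ← mul_assoc, annihilation_mul_creation, if_pos rfl, sub_mul, one_mul,
    mul_assoc, annihilation_mul_self, mul_zero, sub_zero]

variable {a b : ι}

/-- **`P² = 0`** for the pair operator `P = c_b c_a`. [cite: VondelftRalph2001, §4.2.3 (b_j² = 0)] -/
theorem pair_mul_pair (a b : ι) :
    annihilation b * annihilation a * (annihilation b * annihilation a) = 0 := by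
  rw [mul_assoc, ← mul_assoc (annihilation a) (annihilation b),
    annihilation_mul_annihilation_eq_neg a b, neg_mul, mul_neg, mul_assoc,
    annihilation_mul_self, mul_zero, mul_zero, neg_zero]

/-- `P Pᴴ = 1 - n_a - n_b + n_a n_b` (`= (1 - n_a)(1 - n_b)`) for `a ≠ b`. [cite: VondelftRalph2001, §4.2.3] -/
theorem pair_mul_pair_conjTranspose (hab : a ≠ b) :
    annihilation b * annihilation a * (annihilation b * annihilation a)ᴴ =
      1 - numberAt a - numberAt b + numberAt a * numberAt b := by
  rw [conjTranspose_mul, annihilation_conjTranspose, annihilation_conjTranspose]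
  -- c_b c_a c†_a c†_b = c_b (1 - n_a) c†_b
  have h1 : annihilation b * annihilation a * (creation a * creation b) =
      annihilation b * creation b - annihilation b * numberAt a * creation b := by
    rw [mul_assoc, ← mul_assoc (annihilation a), annihilation_mul_creation, if_pos rfl, sub_mul,
      one_mul, mul_sub, ← numberAt, mul_assoc]
  rw [h1, ← numberAt_mul_annihilation_of_ne hab, mul_assoc, annihilation_mul_creation, if_pos rfl,
    ← numberAt]
  noncomm_ring

/-- `Pᴴ P = n_a n_b` for `a ≠ b`. [cite: VondelftRalph2001, §4.2.3] -/
theorem pair_conjTranspose_mul_pair (hab : a ≠ b) :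
    (annihilation b * annihilation a)ᴴ * (annihilation b * annihilation a) = numberAt a * numberAt b := by
  rw [conjTranspose_mul, annihilation_conjTranspose, annihilation_conjTranspose, mul_assoc,
    ← mul_assoc (creation b), ← numberAt, numberAt_mul_annihilation_of_ne (Ne.symm hab), ← mul_assoc,
    ← numberAt]

/-- `n_a P = 0`. [folklore] -/
theorem numberAt_left_mul_pair (hab : a ≠ b) :
    numberAt a * (annihilation b * annihilation a) = 0 := by
  rw [← mul_assoc, numberAt_mul_annihilation_of_ne hab, mul_assoc, numberAt_mul_annihilation_self,
    mul_zero]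

/-- `n_b P = 0`. [folklore] -/
theorem numberAt_right_mul_pair (a b : ι) :
    numberAt b * (annihilation b * annihilation a) = 0 := by
  rw [← mul_assoc, numberAt_mul_annihilation_self, zero_mul]

/-- `P n_a = P`. [folklore] -/
theorem pair_mul_numberAt_left (a b : ι) :
    annihilation b * annihilation a * numberAt a = annihilation b * annihilation a := by
  rw [mul_assoc, annihilation_mul_numberAt_self]

/-- `P n_b = P` for `a ≠ b`. [folklore] -/
theorem pair_mul_numberAt_right (hab : a ≠ b) :
    annihilation b * annihilation a * numberAt b = annihilation b * annihilation a := by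
  rw [mul_assoc, ← numberAt_mul_annihilation_of_ne (Ne.symm hab), ← mul_assoc,
    annihilation_mul_numberAt_self]

/-- `N' P = -P` for `N' = n_a + n_b - 1`. [folklore] -/
theorem shiftedNumber_mul_pair (hab : a ≠ b) :
    (numberAt a + numberAt b - 1) * (annihilation b * annihilation a) =
      -(annihilation b * annihilation a) := by
  rw [sub_mul, add_mul, numberAt_left_mul_pair hab, numberAt_right_mul_pair, one_mul]
  abel

/-- `P N' = P`. [folklore] -/
theorem pair_mul_shiftedNumber (hab : a ≠ b) :
    annihilation b * annihilation a * (numberAt a + numberAt b - 1) =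
      annihilation b * annihilation a := by
  rw [mul_sub, mul_add, pair_mul_numberAt_left, pair_mul_numberAt_right hab, mul_one]
  abel

/-- `N'` is Hermitian. [folklore] -/
theorem shiftedNumber_conjTranspose (a b : ι) :
    (numberAt a + numberAt b - 1 : Matrix (Finset ι) (Finset ι) ℂ)ᴴ = numberAt a + numberAt b - 1 := by
  rw [conjTranspose_sub, conjTranspose_add, (numberAt_isHermitian a).eq, (numberAt_isHermitian b).eq,
    conjTranspose_one]

/-- `N' Pᴴ = Pᴴ`. [folklore] -/
theorem shiftedNumber_mul_pair_conjTranspose (hab : a ≠ b) :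
    (numberAt a + numberAt b - 1) * (annihilation b * annihilation a)ᴴ =
      (annihilation b * annihilation a)ᴴ := by
  have h := congrArg conjTranspose (pair_mul_shiftedNumber hab)
  rwa [conjTranspose_mul, shiftedNumber_conjTranspose] at h

/-- `Pᴴ N' = -Pᴴ`. [folklore] -/
theorem pair_conjTranspose_mul_shiftedNumber (hab : a ≠ b) :
    (annihilation b * annihilation a)ᴴ * (numberAt a + numberAt b - 1) =
      -(annihilation b * annihilation a)ᴴ := by
  have h := congrArg conjTranspose (shiftedNumber_mul_pair hab)
  rwa [conjTranspose_mul, shiftedNumber_conjTranspose, conjTranspose_neg] at h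

/-- **Anticommutation of `N'` with the Hermitian pair field `S = P + Pᴴ`**: `N'S + SN' = 0`. [folklore] -/
theorem shiftedNumber_anticomm_pairField (hab : a ≠ b) :
    (numberAt a + numberAt b - 1) * (annihilation b * annihilation a + (annihilation b * annihilation a)ᴴ) +
      (annihilation b * annihilation a + (annihilation b * annihilation a)ᴴ) * (numberAt a + numberAt b - 1) = 0 := by
  rw [mul_add, add_mul, shiftedNumber_mul_pair hab, shiftedNumber_mul_pair_conjTranspose hab,
    pair_mul_shiftedNumber hab, pair_conjTranspose_mul_shiftedNumber hab]
  abel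

/-- `n_a n_b = n_b n_a` and `n_i² = n_i`, packaged: `N'² = 1 - n_a - n_b + 2 n_a n_b`. [folklore] -/
theorem shiftedNumber_sq (a b : ι) :
    (numberAt a + numberAt b - 1) * (numberAt a + numberAt b - 1) =
      (1 - numberAt a - numberAt b + 2 • (numberAt a * numberAt b) : Matrix (Finset ι) (Finset ι) ℂ) := by
  have ha := (numberAt_idempotent a).eq
  have hb := (numberAt_idempotent b).eq
  have hc := (numberAt_commute b a).eq
  simp only [sub_mul, mul_sub, add_mul, mul_add, one_mul, mul_one, ha, hb, hc, two_smul]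
  abel

/-- **`S² = N'²`** for `S = P + Pᴴ` (`a ≠ b`): both equal `1 - n_a - n_b + 2 n_a n_b`. [folklore] -/
theorem pairField_sq (hab : a ≠ b) :
    (annihilation b * annihilation a + (annihilation b * annihilation a)ᴴ) *
        (annihilation b * annihilation a + (annihilation b * annihilation a)ᴴ) =
      (1 - numberAt a - numberAt b + 2 • (numberAt a * numberAt b) : Matrix (Finset ι) (Finset ι) ℂ) := by
  have hPP : (annihilation b * annihilation a)ᴴ * (annihilation b * annihilation a)ᴴ = 0 := by
    rw [← conjTranspose_mul, pair_mul_pair, conjTranspose_zero]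
  rw [add_mul, mul_add, mul_add, pair_mul_pair, pair_mul_pair_conjTranspose hab,
    pair_conjTranspose_mul_pair hab, hPP, two_smul]
  abel

/-- `N'³ = N'` (the eigenvalues of `N'` are `0, ±1`). [folklore] -/
theorem shiftedNumber_cube (a b : ι) :
    (numberAt a + numberAt b - 1) * (numberAt a + numberAt b - 1) * (numberAt a + numberAt b - 1) =
      (numberAt a + numberAt b - 1 : Matrix (Finset ι) (Finset ι) ℂ) := by
  have ha := (numberAt_idempotent a).eq
  have hb := (numberAt_idempotent b).eq
  have hc := (numberAt_commute b a).eq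
  have h1 : numberAt a * numberAt b * numberAt a = numberAt a * numberAt b := by
    rw [mul_assoc, hc, ← mul_assoc, ha]
  have h2 : numberAt a * numberAt b * numberAt b = numberAt a * numberAt b := by
    rw [mul_assoc, hb]
  rw [shiftedNumber_sq]
  simp only [sub_mul, add_mul, mul_sub, mul_add, one_mul, mul_one, smul_mul_assoc, hc]
  simp only [ha, hb, h1, h2]
  abel

/-- `Q := 1 - n_a - n_b + 2 n_a n_b` is idempotent (it is the projection onto the even two-mode
states). [folklore] -/
theorem evenProj_mul_evenProj (a b : ι) :
    (1 - numberAt a - numberAt b + 2 • (numberAt a * numberAt b) : Matrix (Finset ι) (Finset ι) ℂ) *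
        (1 - numberAt a - numberAt b + 2 • (numberAt a * numberAt b)) =
      1 - numberAt a - numberAt b + 2 • (numberAt a * numberAt b) := by
  rw [← shiftedNumber_sq, mul_assoc, ← mul_assoc (numberAt a + numberAt b - 1) (numberAt a + numberAt b - 1)
    (numberAt a + numberAt b - 1), shiftedNumber_cube]

/-- `Q N' = N'`. [folklore] -/
theorem evenProj_mul_shiftedNumber (a b : ι) :
    (1 - numberAt a - numberAt b + 2 • (numberAt a * numberAt b) : Matrix (Finset ι) (Finset ι) ℂ) *
        (numberAt a + numberAt b - 1) = numberAt a + numberAt b - 1 := by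
  rw [← shiftedNumber_sq, shiftedNumber_cube]

/-- `N' Q = N'`. [folklore] -/
theorem shiftedNumber_mul_evenProj (a b : ι) :
    (numberAt a + numberAt b - 1 : Matrix (Finset ι) (Finset ι) ℂ) *
        (1 - numberAt a - numberAt b + 2 • (numberAt a * numberAt b)) = numberAt a + numberAt b - 1 := by
  rw [← shiftedNumber_sq, ← mul_assoc, shiftedNumber_cube]

/-- `Q S = S` for the pair field `S = P + Pᴴ` (`a ≠ b`). [folklore] -/
theorem evenProj_mul_pairField (hab : a ≠ b) :
    (1 - numberAt a - numberAt b + 2 • (numberAt a * numberAt b) : Matrix (Finset ι) (Finset ι) ℂ) *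
        (annihilation b * annihilation a + (annihilation b * annihilation a)ᴴ) =
      annihilation b * annihilation a + (annihilation b * annihilation a)ᴴ := by
  rw [← shiftedNumber_sq, mul_assoc, mul_add, shiftedNumber_mul_pair hab,
    shiftedNumber_mul_pair_conjTranspose hab, mul_add, mul_neg, shiftedNumber_mul_pair hab, neg_neg,
    shiftedNumber_mul_pair_conjTranspose hab]

/-- `S Q = S` (`a ≠ b`). [folklore] -/
theorem pairField_mul_evenProj (hab : a ≠ b) :
    (annihilation b * annihilation a + (annihilation b * annihilation a)ᴴ) *
        (1 - numberAt a - numberAt b + 2 • (numberAt a * numberAt b) : Matrix (Finset ι) (Finset ι) ℂ) =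
      annihilation b * annihilation a + (annihilation b * annihilation a)ᴴ := by
  rw [← shiftedNumber_sq, ← mul_assoc, add_mul, pair_mul_shiftedNumber hab,
    pair_conjTranspose_mul_shiftedNumber hab, add_mul, neg_mul, pair_mul_shiftedNumber hab,
    pair_conjTranspose_mul_shiftedNumber hab, neg_neg]

/-- **The BdG block squares to a multiple of the even projection**: for real `ξ, Δ` and
`X = ξ N' + Δ S`, `X² = (ξ² + Δ²) Q`. [cite: deGennes1966, Ch. 5 (Bogoliubov quasiparticle energies E = √(ξ²+Δ²))] -/
theorem bdgBlock_sq (hab : a ≠ b) (ξ Δ : ℝ) :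
    ((ξ : ℂ) • (numberAt a + numberAt b - 1) +
        (Δ : ℂ) • (annihilation b * annihilation a + (annihilation b * annihilation a)ᴴ)) *
      ((ξ : ℂ) • (numberAt a + numberAt b - 1) +
        (Δ : ℂ) • (annihilation b * annihilation a + (annihilation b * annihilation a)ᴴ)) =
      ((ξ ^ 2 + Δ ^ 2 : ℝ) : ℂ) •
        (1 - numberAt a - numberAt b + 2 • (numberAt a * numberAt b) : Matrix (Finset ι) (Finset ι) ℂ) := by
  have hanti := shiftedNumber_anticomm_pairField hab
  set N := (numberAt a + numberAt b - 1 : Matrix (Finset ι) (Finset ι) ℂ) with hN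
  set T := (annihilation b * annihilation a + (annihilation b * annihilation a)ᴴ :
    Matrix (Finset ι) (Finset ι) ℂ) with hT
  have hNN : N * N = 1 - numberAt a - numberAt b + 2 • (numberAt a * numberAt b) := shiftedNumber_sq a b
  have hTT : T * T = 1 - numberAt a - numberAt b + 2 • (numberAt a * numberAt b) := pairField_sq hab
  have hcross : (ξ : ℂ) • N * ((Δ : ℂ) • T) + (Δ : ℂ) • T * ((ξ : ℂ) • N) = 0 := by
    rw [smul_mul_smul_comm, smul_mul_smul_comm, mul_comm (Δ : ℂ) (ξ : ℂ), ← smul_add, hanti, smul_zero]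
  rw [add_mul, mul_add, mul_add, add_assoc, ← add_assoc ((ξ : ℂ) • N * ((Δ : ℂ) • T)), hcross, zero_add,
    smul_mul_smul_comm, smul_mul_smul_comm, hNN, hTT, ← add_smul]
  congr 1
  push_cast
  ring

/-- `Q X = X` for the BdG block. [folklore] -/
theorem evenProj_mul_bdgBlock (hab : a ≠ b) (ξ Δ : ℝ) :
    (1 - numberAt a - numberAt b + 2 • (numberAt a * numberAt b) : Matrix (Finset ι) (Finset ι) ℂ) *
      ((ξ : ℂ) • (numberAt a + numberAt b - 1) +
        (Δ : ℂ) • (annihilation b * annihilation a + (annihilation b * annihilation a)ᴴ)) =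
      (ξ : ℂ) • (numberAt a + numberAt b - 1) +
        (Δ : ℂ) • (annihilation b * annihilation a + (annihilation b * annihilation a)ᴴ) := by
  rw [mul_add, mul_smul_comm, mul_smul_comm, evenProj_mul_shiftedNumber, evenProj_mul_pairField hab]

/-- `X Q = X` for the BdG block. [folklore] -/
theorem bdgBlock_mul_evenProj (hab : a ≠ b) (ξ Δ : ℝ) :
    ((ξ : ℂ) • (numberAt a + numberAt b - 1) +
        (Δ : ℂ) • (annihilation b * annihilation a + (annihilation b * annihilation a)ᴴ)) *
      (1 - numberAt a - numberAt b + 2 • (numberAt a * numberAt b) : Matrix (Finset ι) (Finset ι) ℂ) =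
      (ξ : ℂ) • (numberAt a + numberAt b - 1) +
        (Δ : ℂ) • (annihilation b * annihilation a + (annihilation b * annihilation a)ᴴ) := by
  rw [add_mul, smul_mul_assoc, smul_mul_assoc, shiftedNumber_mul_evenProj, pairField_mul_evenProj hab]

end PairAlgebra

end Literature.MathematicalPhysics.QuantumLattice
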